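import Summits.Ventures.PercRepro.C026GluingHA
import Summits.Ventures.PercRepro.ConnJoin

/-!
# The H-graph of a gluing is the join of the parts' H-graphs on the terminals (generic)

Parts `pe`, terminals `Cen`, every edge at a non-terminal in its part (`hpart`, as in `ConnJoin`);
a configuration `S`, the centre mark `c` with `M = cluster S c`, and an avoid set `X` closed under
`S`-connectivity.  A **within-part H-step** `HAdjIn S c pe i` is an H-step of `C026HGraph` whose
edge lies in the part `i` (kinds (1), (2)) or whose connectivity is inside the part (kind (3),
`ConnIn`); `M` itself stays global.  `hConnAvoid_iff_hchain`: between terminals outside `X`, an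
H-walk avoiding `X` is the same as a chain of terminal-to-terminal within-part H-connections.  This is
Lemma 3 (with Lemma 4) of the 4-terminal profile theorem: the type of a gluing — `BAD`, `o1`, `o2`
— is a function of the parts' H-connectivity relations on the terminals (`hBad_iff_hchain`,
`hO1_iff_hchain`, `hO2_iff_hchain` for the forms `HBad` / `HO1` / `HO2` of `C026GluingHA`).
-/

namespace PercRepro

namespace MultiGraph

section HJoin

variable {V E ι : Type*} (G : MultiGraph V E)

/-- A within-part H-step (relative to the global `M = cluster S c`). -/
def HAdjIn (S : Config E) (c : V) (pe : E → ι) (i : ι) (u v : V) : Prop :=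
  (u ∈ G.cluster S c ∧ v ∈ G.cluster S c ∧ ∃ e, pe e = i ∧ S e = false ∧ G.Joins e u v) ∨
    ((u ∈ G.cluster S c ↔ v ∉ G.cluster S c) ∧ ∃ e, pe e = i ∧ G.Joins e u v) ∨
      (u ∉ G.cluster S c ∧ v ∉ G.cluster S c ∧ G.ConnIn S pe i u v)

/-- Within-part H-walks avoiding `X`. -/
def HConnAvoidIn (S : Config E) (c : V) (pe : E → ι) (i : ι) (X : Set V) (u v : V) : Prop :=
  Relation.ReflTransGen (fun x y => G.HAdjIn S c pe i x y ∧ x ∉ X ∧ y ∉ X) u v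

/-- One step of the H-join: two terminals outside `X`, H-connected inside one part avoiding `X`. -/
def HJoinStep (S : Config E) (c : V) (pe : E → ι) (Cen X : Set V) (t t' : V) : Prop :=
  t ∈ Cen ∧ t' ∈ Cen ∧ t ∉ X ∧ t' ∉ X ∧ ∃ i, G.HConnAvoidIn S c pe i X t t'

variable {G}

/-- A within-part H-step is an H-step. -/
theorem HAdjIn.hAdj {S : Config E} {c : V} {pe : E → ι} {i : ι} {u v : V}
    (h : G.HAdjIn S c pe i u v) : G.HAdj S c u v := by
  rcases h with ⟨hu, hv, e, _, he, hj⟩ | ⟨hiff, e, _, hj⟩ | ⟨hu, hv, hc⟩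
  · exact Or.inl ⟨hu, hv, e, he, hj⟩
  · exact Or.inr (Or.inl ⟨hiff, e, hj⟩)
  · exact Or.inr (Or.inr ⟨hu, hv, hc.conn⟩)

/-- A within-part H-step is symmetric. -/
theorem HAdjIn.symm {S : Config E} {c : V} {pe : E → ι} {i : ι} {u v : V}
    (h : G.HAdjIn S c pe i u v) : G.HAdjIn S c pe i v u := by
  rcases h with ⟨hu, hv, e, hi, he, hj⟩ | ⟨hiff, e, hi, hj⟩ | ⟨hu, hv, hc⟩
  · exact Or.inl ⟨hv, hu, e, hi, he, hj.symm⟩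
  · refine Or.inr (Or.inl ⟨⟨fun hv hu => hiff.mp hu hv, fun hu => ?_⟩, e, hi, hj.symm⟩)
    by_contra hv
    exact hu (hiff.mpr hv)
  · exact Or.inr (Or.inr ⟨hv, hu, connIn_symm hc⟩)

/-- A within-part H-walk is symmetric. -/
theorem HConnAvoidIn.symm {S : Config E} {c : V} {pe : E → ι} {i : ι} {X : Set V} {u v : V}
    (h : G.HConnAvoidIn S c pe i X u v) : G.HConnAvoidIn S c pe i X v u := by
  induction h with
  | refl => exact Relation.ReflTransGen.refl
  | tail _ hxy ih => exact ih.head ⟨hxy.1.symm, hxy.2.2, hxy.2.1⟩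

/-- An H-join step is symmetric (so the H-chain is reachability of a symmetric relation on the
terminals — decidable on finite types by `ReachFromRel`). -/
theorem HJoinStep.symm {S : Config E} {c : V} {pe : E → ι} {Cen X : Set V} {t t' : V}
    (h : G.HJoinStep S c pe Cen X t t') : G.HJoinStep S c pe Cen X t' t :=
  ⟨h.2.1, h.1, h.2.2.2.1, h.2.2.1, h.2.2.2.2.elim fun i hi => ⟨i, hi.symm⟩⟩

/-- A within-part H-walk is an H-walk. -/
theorem HConnAvoidIn.hConnAvoid {S : Config E} {c : V} {pe : E → ι} {i : ι} {X : Set V} {u v : V}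
    (h : G.HConnAvoidIn S c pe i X u v) : G.HConnAvoid S c X u v := by
  induction h with
  | refl => exact Relation.ReflTransGen.refl
  | tail _ hxy ih => exact ih.tail ⟨hxy.1.hAdj, hxy.2.1, hxy.2.2⟩

/-- An H-join step is an H-walk. -/
theorem HJoinStep.hConnAvoid {S : Config E} {c : V} {pe : E → ι} {Cen X : Set V} {t t' : V}
    (h : G.HJoinStep S c pe Cen X t t') : G.HConnAvoid S c X t t' :=
  h.2.2.2.2.elim fun _ hi => hi.hConnAvoid

/-- A chain of H-join steps is an H-walk. -/
theorem hConnAvoid_of_hchain {S : Config E} {c : V} {pe : E → ι} {Cen X : Set V} {u v : V}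
    (h : Relation.ReflTransGen (G.HJoinStep S c pe Cen X) u v) : G.HConnAvoid S c X u v := by
  induction h with
  | refl => exact Relation.ReflTransGen.refl
  | tail _ htt ih => exact ih.trans htt.hConnAvoid

/-- The invariant of the H-walk: at a terminal, a chain of H-join steps from `u`; at a non-terminal
`w`, a chain to a terminal `z ∉ X` and a within-part H-walk `z → w` in the part of `w`. -/
def HInv (S : Config E) (c : V) (pe : E → ι) (br : V → ι) (Cen X : Set V) (u w : V) : Prop :=
  (w ∈ Cen ∧ Relation.ReflTransGen (G.HJoinStep S c pe Cen X) u w) ∨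
    (w ∉ Cen ∧ ∃ z, z ∈ Cen ∧ z ∉ X ∧ Relation.ReflTransGen (G.HJoinStep S c pe Cen X) u z ∧
      G.HConnAvoidIn S c pe (br w) X z w)

/-- One within-part H-step carries the invariant, provided its part is the part of its
non-terminal endpoints. -/
theorem HInv.step {S : Config E} {c : V} {pe : E → ι} {br : V → ι} {Cen X : Set V} {u w w' : V}
    {i : ι} (hiw : w ∉ Cen → i = br w) (hiw' : w' ∉ Cen → i = br w')
    (hstep : G.HAdjIn S c pe i w w') (hwX : w ∉ X) (hw'X : w' ∉ X)
    (hinv : G.HInv S c pe br Cen X u w) : G.HInv S c pe br Cen X u w' := by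
  by_cases hw'C : w' ∈ Cen
  · refine Or.inl ⟨hw'C, ?_⟩
    rcases hinv with ⟨hwC, hJ⟩ | ⟨hwC, z, hzC, hzX, hJ, hin⟩
    · exact hJ.tail ⟨hwC, hw'C, hwX, hw'X, i, Relation.ReflTransGen.single ⟨hstep, hwX, hw'X⟩⟩
    · refine hJ.tail ⟨hzC, hw'C, hzX, hw'X, br w, hin.tail ⟨?_, hwX, hw'X⟩⟩
      rw [← hiw hwC]
      exact hstep
  · refine Or.inr ⟨hw'C, ?_⟩
    rcases hinv with ⟨hwC, hJ⟩ | ⟨hwC, z, hzC, hzX, hJ, hin⟩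
    · refine ⟨w, hwC, hwX, hJ, Relation.ReflTransGen.single ⟨?_, hwX, hw'X⟩⟩
      rw [← hiw' hw'C]
      exact hstep
    · refine ⟨z, hzC, hzX, hJ, ?_⟩
      have hbr : br w' = br w := by rw [← hiw' hw'C, hiw hwC]
      rw [hbr]
      refine hin.tail ⟨?_, hwX, hw'X⟩
      rw [← hiw hwC]
      exact hstep

/-- The part of an edge is the part of each of its non-terminal endpoints. -/
theorem part_of_joins {Cen : Set V} {pe : E → ι} {br : V → ι}
    (hpart : ∀ e, (G.fst e ∉ Cen → pe e = br (G.fst e)) ∧ (G.snd e ∉ Cen → pe e = br (G.snd e)))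
    {e : E} {w w' : V} (hj : G.Joins e w w') :
    (w ∉ Cen → pe e = br w) ∧ (w' ∉ Cen → pe e = br w') := by
  rcases hj with ⟨h1, h2⟩ | ⟨h1, h2⟩
  · exact ⟨fun hw => h1 ▸ (hpart e).1 (h1 ▸ hw), fun hw' => h2 ▸ (hpart e).2 (h2 ▸ hw')⟩
  · exact ⟨fun hw => h2 ▸ (hpart e).2 (h2 ▸ hw), fun hw' => h1 ▸ (hpart e).1 (h1 ▸ hw')⟩

/-- A kind-(3) H-step (`S`-connectivity outside `M`) carries the invariant: the open walk is a
sequence of within-part kind-(3) steps through vertices outside `M` and `X`. -/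
theorem HInv.conn {S : Config E} {c : V} {pe : E → ι} {br : V → ι} {Cen X : Set V}
    (hpart : ∀ e, (G.fst e ∉ Cen → pe e = br (G.fst e)) ∧ (G.snd e ∉ Cen → pe e = br (G.snd e)))
    (hX : ∀ u v, u ∉ X → G.Conn S u v → v ∉ X) {u w w' : V}
    (hwM : w ∉ G.cluster S c) (hwX : w ∉ X) (hconn : G.Conn S w w')
    (hinv : G.HInv S c pe br Cen X u w) : G.HInv S c pe br Cen X u w' := by
  refine Conn.induction (motive := fun v => G.HInv S c pe br Cen X u v) hinv
    (fun {a b} hwa hab ih => ?_) hconn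
  -- `a ∉ M`, `b ∉ M` (both in the cluster of `w`), `a ∉ X`, `b ∉ X`
  have haM : a ∉ G.cluster S c := G.not_mem_cluster_c_of_mem_cluster hwM hwa
  have hbM : b ∉ G.cluster S c := G.not_mem_cluster_c_of_mem_cluster hwM (hwa.tail hab)
  have haX : a ∉ X := hX w a hwX hwa
  have hbX : b ∉ X := hX w b hwX (hwa.tail hab)
  obtain ⟨e, he, hend⟩ := hab
  have hj : G.Joins e a b := hend
  have hp := part_of_joins hpart hj
  refine HInv.step hp.1 hp.2 (Or.inr (Or.inr ⟨haM, hbM, Relation.ReflTransGen.single ⟨e, rfl, he, hend⟩⟩))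
    haX hbX ih

/-- **Lemma 3 (join for H-walks).** Between terminals outside `X`, an H-walk avoiding `X` is a chain
of terminal-to-terminal within-part H-connections. -/
theorem hConnAvoid_iff_hchain (S : Config E) (c : V) (pe : E → ι) (br : V → ι) (Cen X : Set V)
    (hpart : ∀ e, (G.fst e ∉ Cen → pe e = br (G.fst e)) ∧ (G.snd e ∉ Cen → pe e = br (G.snd e)))
    (hX : ∀ u v, u ∉ X → G.Conn S u v → v ∉ X) {u v : V} (hu : u ∈ Cen) (hv : v ∈ Cen) :
    G.HConnAvoid S c X u v ↔ Relation.ReflTransGen (G.HJoinStep S c pe Cen X) u v := by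
  refine ⟨fun h => ?_, hConnAvoid_of_hchain⟩
  have inv : ∀ {w : V}, G.HConnAvoid S c X u w → G.HInv S c pe br Cen X u w := by
    intro w hw
    unfold HConnAvoid at hw
    induction hw with
    | refl => exact Or.inl ⟨hu, Relation.ReflTransGen.refl⟩
    | @tail w w' _ hstep ih =>
      obtain ⟨hadj, hwX, hw'X⟩ := hstep
      rcases hadj with ⟨hwM, hw'M, e, he, hj⟩ | ⟨hiff, e, hj⟩ | ⟨hwM, _, hconn⟩
      · have hp := part_of_joins hpart hj
        exact HInv.step hp.1 hp.2 (Or.inl ⟨hwM, hw'M, e, rfl, he, hj⟩) hwX hw'X ih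
      · have hp := part_of_joins hpart hj
        exact HInv.step hp.1 hp.2 (Or.inr (Or.inl ⟨hiff, e, rfl, hj⟩)) hwX hw'X ih
      · exact HInv.conn hpart hX hwM hwX hconn ih
  rcases inv h with ⟨_, hJ⟩ | ⟨hvC, _⟩
  · exact hJ
  · exact absurd hv hvC

/-- A cluster is closed under connectivity (the avoid sets of `HO1` / `HO2`). -/
theorem cluster_closed_under_conn (S : Config E) (b : V) :
    ∀ u v, u ∉ G.cluster S b → G.Conn S u v → v ∉ G.cluster S b :=
  fun _ _ hu huv hv => hu ((G.mem_cluster.1 hv).trans huv.symm)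

/-- **The type of a gluing, `BAD`**: `a ~_H b` iff a chain of within-part H-connections joins the
terminals `a` and `b`. -/
theorem hBad_iff_hchain (S : Config E) (pe : E → ι) (br : V → ι) (Cen : Set V)
    (hpart : ∀ e, (G.fst e ∉ Cen → pe e = br (G.fst e)) ∧ (G.snd e ∉ Cen → pe e = br (G.snd e)))
    {a b c : V} (ha : a ∈ Cen) (hb : b ∈ Cen) :
    G.HBad S a b c ↔ Relation.ReflTransGen (G.HJoinStep S c pe Cen ∅) a b := by
  -- `HConn` is `HConnAvoid` with nothing avoided (p5's `PairModel.hConn_iff_hConnAvoid_empty`, inlined)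
  have hempty : ∀ u v : V, G.HConn S c u v ↔ G.HConnAvoid S c ∅ u v := by
    intro u v
    constructor
    · intro h
      induction h with
      | refl => exact Relation.ReflTransGen.refl
      | tail _ hxy ih => exact ih.tail ⟨hxy, Set.notMem_empty _, Set.notMem_empty _⟩
    · intro h
      induction h with
      | refl => exact Relation.ReflTransGen.refl
      | tail _ hxy ih => exact ih.tail hxy.1
  rw [HBad, hempty]
  exact G.hConnAvoid_iff_hchain S c pe br Cen ∅ hpart (fun _ _ _ _ => Set.notMem_empty _) ha hb

/-- **The type of a gluing, `o1`**: `c ~_H a` avoiding the cluster of `b` iff a chain of within-part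
H-connections avoiding it joins `c` and `a`. -/
theorem hO1_iff_hchain (S : Config E) (pe : E → ι) (br : V → ι) (Cen : Set V)
    (hpart : ∀ e, (G.fst e ∉ Cen → pe e = br (G.fst e)) ∧ (G.snd e ∉ Cen → pe e = br (G.snd e)))
    {a b c : V} (ha : a ∈ Cen) (hc : c ∈ Cen) :
    G.HO1 S a b c ↔ Relation.ReflTransGen (G.HJoinStep S c pe Cen (G.cluster S b)) c a :=
  G.hConnAvoid_iff_hchain S c pe br Cen (G.cluster S b) hpart (G.cluster_closed_under_conn S b) hc ha

/-- **The type of a gluing, `o2`**: the mirror image of `o1`. -/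
theorem hO2_iff_hchain (S : Config E) (pe : E → ι) (br : V → ι) (Cen : Set V)
    (hpart : ∀ e, (G.fst e ∉ Cen → pe e = br (G.fst e)) ∧ (G.snd e ∉ Cen → pe e = br (G.snd e)))
    {a b c : V} (hb : b ∈ Cen) (hc : c ∈ Cen) :
    G.HO2 S a b c ↔ Relation.ReflTransGen (G.HJoinStep S c pe Cen (G.cluster S a)) c b :=
  G.hConnAvoid_iff_hchain S c pe br Cen (G.cluster S a) hpart (G.cluster_closed_under_conn S a) hc hb

end HJoin

end MultiGraph

end PercRepro
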